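import Summits.ABC.IUTFork.Repair.RHReqsideWeightLawsSign
import HarnessLib

/-!
# D-0122 AXIS B, knob k1 — THE TYPED FORM, part 3b: `T(κ, ·)` at the DATUM (pooled sign theorem, VANISHES ⟺ every place vanishes), the k5
# coupling `T(μ₀) ≤ μ₀·T(1)` and the tier-L0 «ratio ≥ 1» cell in `(K, T)` form, and the worked place FREY `p = 7`, `l = 107` per law

abc-iut cell, rung LADDER-ABC:A2.RESCUE.H; seat abc-iut-reqb-typ-1 (GEN 3; D-0122 axis B typer k1/k4, director-abc g4-D24 payload «`T(κ,·)` as a theorem»);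
owner abc-iut-rh-lead g3/g4 (`plan/rescue/R-H/ROUND3/REQB-SPEC.md` v0.2 §1 k1/k5, §6(a)(P2)/(P3)/(P4)); table of record `REQB-TABLE.tsv` v1 b8ac679ede5d795b;
referee abc-iut-reqb-ref-1 (worked-place digits WP-GRID-ref-1-v1 c1c60d110a62a744). Part 3a = `Repair/RHReqsideWeightLawsSign.lean` (this seat: the place
threshold `offDemand`, kept demand `keptDemand`, THE k1 SIGN THEOREM `offDemand_mono_law`, VANISHES ⟺ saturation, the κ-chain, evaluation on a segment place);
parts 1/2 = p506542 / p508156 (`Cell`, laws, `demandSum` closed forms, `reqThreshold`). Nothing re-typed; all statements BY NAME over those.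
* §3 DATUM LEVEL `datumOff f den s e m δ r_in r_out q L := Σ_{w ∈ s} (offDemand_w/den)·q_w` and `datumKept` (`q_w = m_q(w)·u_w ≥ 0`, any finite place set —
  the shape of the kit's datum ↔ places map, whose numerals stay the engines'): `datumOff_mono_law` (**the sign theorem pooled: a lighter law never raises a
  datum's `T`**, hence neither a bed's pooled `T` nor any order statistic of a datum-wise dominated column), `datumOff_eq_zero_iff` (VANISHES at the datum ⟺ at
  every place, `q_w > 0`); k5 COUPLING over part 2's `reqThreshold μ₀ M K = (μ₀M − K)⁺` with `M = K + T`: `reqThreshold_one_add` (`T(1) = T`),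
  `reqThreshold_add_le` (`0 ≤ μ₀ ≤ 1`: **`T(μ₀) ≤ μ₀·T`** — so for `κ ≤ 2` every k1 × k5 row has `T_mod(μ₀) ≤ μ₀·T_mod(1) ≤ μ₀·T_print` datum by datum),
  `reqThreshold_mono_M` / `reqThreshold_anti_K`, and `reqThreshold_add_eq_zero_iff`: **the tier-L0 «ratio ≥ 1» cell `ρ⁰ ≥ 1 ⟺ μ₀·T ≤ (1 − μ₀)·K`**
  (REQB-SPEC §6(a)(P2) strict twin). CAVEAT kept explicit: `K_{L0}` is NOT monotone in the law (a lighter law licenses more labels but credits each less), so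
  the ratio words at `μ₀ < 1` and the exact-slack tier L1 of the ratio of record `ρ` remain the engines' (A ≡ B) — only the SIGN of `T` is a theorem.
  Also `offDemand_mono_L` (`T` nondecreasing in the label range at fixed place integers) and `offDemand_id_tower_eq_zero` (k1 × k4: under `κ = 1`, VANISHES
  persists at every tower scale `t ≥ 1` of the allowance and every label range).
* §4 WORKED PLACE FREY `p = 7`, `l = 107` (`e 1605, m 210, δ 1604, r_in 268, r_out −4472, L = l⋆ = 53`; part 1 §3): the boundaries as `iff`s over all `53`
  labels by `decide` — print `31`, shift `a = 1` `29`, affine `c₁ = 2` `15` — hence by part 3a's `offDemand_eq_of_boundary` and part 1's closed forms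
  `T_print = S(53) − S(31) = 50986 − 10385 = 40601` (referee: `MM = 10707060 = 210·50986`, `μ₄ = 0.20368 = 10385/50986`), `T_{κ=1} = T_{κ=3/2} = 0`
  (VANISHES: part 1 `worked_kappaOne_all` / `worked_kappaThreeHalves_all`), `T_shift1 = 53742 − 9338 = 44404`, `T_affine2 = 102025 − 2465 = 99560`, and
  `T_{κ=5/2}, T_{κ=3} ≥ 40601` by the κ-chain with no root evaluated (label units, ×`m_q u_w` for nats); and `worked_keptDemand`: `K_L0 = 10385` at print vs
  `1378` under `κ = 1` — the kept side is NOT monotone in the law, so only the sign of `T` is a theorem.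
HONEST FRAMING: integer/real arithmetic about OUR typed cell with a free pilot law (a PARAMETER — REQB-SPEC FRAMING; the CONSISTENCY of any law other than
`j²` with IUT I–III is abc-iut-reqb-rf-1's column, not asserted here); tier L0 only; nothing here asserts that abc is proved or refuted, or that [IUTchIII]
Cor. 3.12 / [IUTchIV] Thm. 1.10 holds or fails at any datum, or takes a side on any author; typed ≠ proved; computed ≠ proved.
[claim: Mochizuki2012, status: disputed] for every IUT locution.
[cite: Mochizuki2012, IUTchIII Cor. 3.12 p. 173–174, Rmk. 3.9.3 p. 119–120; IUTchIV Prop. 1.4 p. 13, Thm. 1.10 Step (v) p. 27–29]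
-/

noncomputable section

open Finset

namespace Summit.ABC.IUTFork.Repair.RH.ReqsideWeightLaws

/-! ## §3. Datum level and the k5 coupling -/

/-- **`T` IS NONDECREASING IN THE LABEL RANGE at fixed place integers** (demands `≥ 0`): `T_f(w; L) ≤ T_f(w; L+1)` — each extra label is pure requirement
unless licensed (reqb-typ-2's `ReqsideLabelsInd.unlicensedMass_mono` is the print/segment case). Along the genuine `l`-tower the place integers move with
`l` as well (part 3a `cell_scale`, `cell_lProfile_mono`); this is the fixed-data half of the k1 × k4 profile. [folklore] -/
theorem offDemand_mono_L {f : ℕ → ℤ} {den : ℤ} (hf : ∀ j, 1 ≤ j → den ≤ f j) (e m δ rin rout : ℤ) {L L' : ℕ} (hL : L ≤ L') :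
    offDemand f den e m δ rin rout L ≤ offDemand f den e m δ rin rout L' := by
  unfold offDemand
  refine Finset.sum_le_sum_of_subset_of_nonneg (Finset.range_subset_range.mpr hL) fun i _ _ => ?_
  split_ifs
  · exact le_rfl
  · linarith [hf (i + 1) (Nat.succ_pos i)]

/-- **k1 × k4: under `κ = 1`, VANISHES PERSISTS UP THE TOWER.** If `m ≤ δ + (r_in − r_out)` at a place (`e > 0`, `δ ≥ 0`, `r_out ≤ r_in`), then at every
tower scale `t ≥ 1` of the allowance (first-order model of raising `l`: `(e, δ, r_in, r_out) ↦ t·(e, δ, r_in, r_out)` at fixed `m_q`, reqb-typ-2 §2) and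
EVERY label range `L′`, `T_{κ=1} = 0` — the `l`-free saturation of part 1 `cell_id_of_le`, read along k4. [folklore] -/
theorem offDemand_id_tower_eq_zero {t e m δ rin rout : ℤ} (he : 0 < e) (hδ : 0 ≤ δ) (hG : rout ≤ rin) (h : m ≤ δ + (rin - rout))
    (ht : 1 ≤ t) (L' : ℕ) : offDemand (fun j => (j : ℤ)) 1 (t * e) m (t * δ) (t * rin) (t * rout) L' = 0 :=
  offDemand_id_eq_zero (mul_pos (by omega) he) (by nlinarith) (by nlinarith) (by nlinarith) L'

/-- **k5 COUPLING, `μ₀ = 1`**: with `M = K + T` (`T ≥ 0`), `reqThreshold 1 (K + T) K = T` — the k5-threshold of part 2 at print's target IS `T`. [folklore] -/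
theorem reqThreshold_one_add {K T : ℝ} (hT : 0 ≤ T) : reqThreshold 1 (K + T) K = T := by
  unfold reqThreshold
  rw [one_mul, add_sub_cancel_left]
  exact max_eq_left hT

/-- **k5 COUPLING, `μ₀ ≤ 1`: `T(μ₀) = (μ₀(K + T) − K)⁺ ≤ μ₀·T`** (`K, T ≥ 0`, `0 ≤ μ₀ ≤ 1`). With the sign theorem: for `κ ≤ 2` every k1 × k5 row has
`T_mod(μ₀) ≤ μ₀·T_mod(1) ≤ μ₀·T_print` datum by datum (the kept side `K_{L0}` itself is NOT monotone in the law — lighter laws license more labels but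
credit each licensed label less — so ratio words at `μ₀ < 1` remain the engines'). [folklore] -/
theorem reqThreshold_add_le {μ₀ K T : ℝ} (hμ0 : 0 ≤ μ₀) (hμ1 : μ₀ ≤ 1) (hK : 0 ≤ K) (hT : 0 ≤ T) :
    reqThreshold μ₀ (K + T) K ≤ μ₀ * T := by
  unfold reqThreshold
  refine max_le ?_ (mul_nonneg hμ0 hT)
  nlinarith

/-- `reqThreshold` is monotone in the requirement `M` (`μ₀ ≥ 0`). [folklore] -/
theorem reqThreshold_mono_M {μ₀ M M' : ℝ} (hμ0 : 0 ≤ μ₀) (h : M ≤ M') (K : ℝ) : reqThreshold μ₀ M K ≤ reqThreshold μ₀ M' K := by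
  unfold reqThreshold
  exact max_le_max (by nlinarith) le_rfl

/-- `reqThreshold` is antitone in the kept mass `K`. [folklore] -/
theorem reqThreshold_anti_K {K K' : ℝ} (h : K ≤ K') (μ₀ M : ℝ) : reqThreshold μ₀ M K' ≤ reqThreshold μ₀ M K := by
  unfold reqThreshold
  exact max_le_max (by linarith) le_rfl

/-- **THE TIER-L0 «ratio ≥ 1» CELL IN `(K, T)` FORM**: `reqThreshold μ₀ (K + T) K = 0 ⟺ μ₀·T ≤ (1 − μ₀)·K` (part 2 `reqThreshold_eq_zero_iff`):
the strict twin `ρ⁰ = K_L0/(μ₀M) ≥ 1` of REQB-SPEC §6(a)(P2), as a linear trade-off between the unlicensed demand and the licensed one. [folklore] -/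
theorem reqThreshold_add_eq_zero_iff (μ₀ K T : ℝ) : reqThreshold μ₀ (K + T) K = 0 ↔ μ₀ * T ≤ (1 - μ₀) * K := by
  rw [reqThreshold_eq_zero_iff]
  constructor <;> intro h <;> nlinarith

/-- **DATUM-LEVEL `T_f`** over a finite set of places `s` with place data `(e, m, δ, r_in, r_out)` and place weights `q_w` (`= m_q(w)·u_w`):
`datumOff … := Σ_{w ∈ s} (offDemand_w/den)·q_w` (nats). [claim: Mochizuki2012, status: disputed] -/
@[claim "Mochizuki2012" "disputed"]
def datumOff {ι : Type*} (f : ℕ → ℤ) (den : ℤ) (s : Finset ι) (e m δ rin rout : ι → ℤ) (q : ι → ℝ) (L : ℕ) : ℝ :=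
  ∑ w ∈ s, ((offDemand f den (e w) (m w) (δ w) (rin w) (rout w) L : ℤ) : ℝ) / (den : ℝ) * q w

/-- **DATUM-LEVEL `K_{L0,f}`**: `Σ_{w ∈ s} (keptDemand_w/den)·q_w`. [claim: Mochizuki2012, status: disputed] -/
@[claim "Mochizuki2012" "disputed"]
def datumKept {ι : Type*} (f : ℕ → ℤ) (den : ℤ) (s : Finset ι) (e m δ rin rout : ι → ℤ) (q : ι → ℝ) (L : ℕ) : ℝ :=
  ∑ w ∈ s, ((keptDemand f den (e w) (m w) (δ w) (rin w) (rout w) L : ℤ) : ℝ) / (den : ℝ) * q w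

section Datum

variable {ι : Type*} {s : Finset ι} {e m δ rin rout : ι → ℤ} {q : ι → ℝ}

/-- `T_f(datum) ≥ 0` (`den > 0`, demands `≥ 0`, weights `≥ 0`). [folklore] -/
theorem datumOff_nonneg {f : ℕ → ℤ} {den : ℤ} (hden : 0 < den) (hf : ∀ j, 1 ≤ j → den ≤ f j) (hq : ∀ w ∈ s, 0 ≤ q w) (L : ℕ) :
    0 ≤ datumOff f den s e m δ rin rout q L := by
  unfold datumOff
  refine Finset.sum_nonneg fun w hw => mul_nonneg (div_nonneg ?_ (by exact_mod_cast hden.le)) (hq w hw)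
  exact_mod_cast offDemand_nonneg hf _ _ _ _ _ L

/-- **THE SIGN THEOREM, POOLED**: `den ≤ f ≤ g` on labels `≥ 1`, every place with `e_w > 0`, `m_w ≥ 0`, `q_w ≥ 0` ⟹ `T_f(datum) ≤ T_g(datum)` — and so for
any bed (pooled sums and every order statistic of a datum-wise dominated column move the same way). [folklore] -/
theorem datumOff_mono_law {f g : ℕ → ℤ} {den : ℤ} (hden : 0 < den) (he : ∀ w ∈ s, 0 < e w) (hm : ∀ w ∈ s, 0 ≤ m w) (hq : ∀ w ∈ s, 0 ≤ q w)
    (hf : ∀ j, 1 ≤ j → den ≤ f j) (hfg : ∀ j, 1 ≤ j → f j ≤ g j) (L : ℕ) :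
    datumOff f den s e m δ rin rout q L ≤ datumOff g den s e m δ rin rout q L := by
  unfold datumOff
  refine Finset.sum_le_sum fun w hw => mul_le_mul_of_nonneg_right ?_ (hq w hw)
  refine div_le_div_of_nonneg_right ?_ (by exact_mod_cast hden.le)
  exact_mod_cast offDemand_mono_law hden (he w hw) (hm w hw) hf hfg L

/-- **VANISHES AT THE DATUM ⟺ VANISHES AT EVERY PLACE** (weights `q_w > 0`, demands `≥ 0`). [folklore] -/
theorem datumOff_eq_zero_iff {f : ℕ → ℤ} {den : ℤ} (hden : 0 < den) (hf : ∀ j, 1 ≤ j → den ≤ f j) (hq : ∀ w ∈ s, 0 < q w) (L : ℕ) :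
    datumOff f den s e m δ rin rout q L = 0 ↔ ∀ w ∈ s, offDemand f den (e w) (m w) (δ w) (rin w) (rout w) L = 0 := by
  unfold datumOff
  have hden' : (0 : ℝ) < (den : ℝ) := by exact_mod_cast hden
  rw [Finset.sum_eq_zero_iff_of_nonneg (fun w hw => mul_nonneg
    (div_nonneg (by exact_mod_cast offDemand_nonneg hf _ _ _ _ _ L) hden'.le) (hq w hw).le)]
  refine ⟨fun h w hw => ?_, fun h w hw => by rw [h w hw]; simp⟩
  have h1 := h w hw
  rcases mul_eq_zero.mp h1 with h2 | h2
  · rw [div_eq_zero_iff] at h2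
    rcases h2 with h3 | h3
    · exact_mod_cast h3
    · exact absurd h3 hden'.ne'
  · exact absurd h2 (hq w hw).ne'

/-- **`M = K_L0 + T` AT THE DATUM, BY NAME over part 2's `reqMass`**: `datumKept + datumOff = reqMass f den L (Σ_{w∈s} q_w)` — the datum's requirement
`M_f` of part 2 (`(demandSum/den)·U`, `U = Σ_w m_q(w)u_w`) splits into the tier-L0 kept mass and the threshold. [folklore] -/
theorem datumKept_add_datumOff (f : ℕ → ℤ) (den : ℤ) (L : ℕ) :
    datumKept f den s e m δ rin rout q L + datumOff f den s e m δ rin rout q L = reqMass f den L (∑ w ∈ s, q w) := by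
  unfold datumKept datumOff reqMass
  rw [← Finset.sum_add_distrib, Finset.mul_sum]
  refine Finset.sum_congr rfl fun w _ => ?_
  have h := congrArg (fun z : ℤ => (z : ℝ)) (keptDemand_add_offDemand f den (e w) (m w) (δ w) (rin w) (rout w) L)
  push_cast at h
  rw [← h]
  ring

/-- **EVERY k1 × k5 ROW AT THE DATUM, tier L0**: `T_f(μ₀) = reqThreshold μ₀ M_f K_{L0,f} ≤ μ₀·T_f` (`0 ≤ μ₀ ≤ 1`, `den > 0`, demands and weights `≥ 0`) — and
for `f ≤ print` further `≤ μ₀·T_print` by `datumOff_mono_law`. [folklore] -/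
theorem datum_reqThreshold_le {f : ℕ → ℤ} {den : ℤ} (hden : 0 < den) (hf : ∀ j, 1 ≤ j → den ≤ f j) (hq : ∀ w ∈ s, 0 ≤ q w)
    {μ₀ : ℝ} (hμ0 : 0 ≤ μ₀) (hμ1 : μ₀ ≤ 1) (L : ℕ) :
    reqThreshold μ₀ (reqMass f den L (∑ w ∈ s, q w)) (datumKept f den s e m δ rin rout q L) ≤ μ₀ * datumOff f den s e m δ rin rout q L := by
  rw [← datumKept_add_datumOff]
  refine reqThreshold_add_le hμ0 hμ1 ?_ (datumOff_nonneg hden hf hq L)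
  unfold datumKept
  refine Finset.sum_nonneg fun w hw => mul_nonneg (div_nonneg ?_ (by exact_mod_cast hden.le)) (hq w hw)
  exact_mod_cast keptDemand_nonneg hf _ _ _ _ _ L

end Datum

/-! ## §4. The worked place FREY `p = 7`, `l = 107` (`e 1605`, `m 210`, `δ 1604`, `r_in 268`, `r_out −4472`, `L = l⋆ = 53`) -/

/-- PRINT BOUNDARY as an `iff` over all `53` labels: `Cell_j ⟺ j ≤ 31` (part 1 `worked_print` gave labels `31`/`32`; referee WP-GRID `j0 31 (seg 1)`). [folklore] -/
theorem worked_print_boundary : ∀ j, 1 ≤ j → j ≤ 53 → (Cell (fun j => (j : ℤ) ^ 2) 1 1605 210 1604 268 (-4472) j ↔ j ≤ 31) := by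
  have h : ∀ i : Fin 53, (Cell (fun j => (j : ℤ) ^ 2) 1 1605 210 1604 268 (-4472) (i.val + 1) ↔ i.val + 1 ≤ 31) := by
    unfold Cell; decide
  intro j hj hjL
  obtain ⟨i, rfl⟩ : ∃ i, j = i + 1 := ⟨j - 1, by omega⟩
  exact h ⟨i, by omega⟩

/-- SHIFT `a = 1` BOUNDARY: `Cell_j ⟺ j ≤ 29`; AFFINE `c₁ = 2` BOUNDARY: `Cell_j ⟺ j ≤ 15` (all `53` labels, `decide`). [folklore] -/
theorem worked_shift_affine_boundary :
    (∀ j, 1 ≤ j → j ≤ 53 → (Cell (lawShift 1) 1 1605 210 1604 268 (-4472) j ↔ j ≤ 29)) ∧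
      (∀ j, 1 ≤ j → j ≤ 53 → (Cell (lawAffine 2) 1 1605 210 1604 268 (-4472) j ↔ j ≤ 15)) := by
  have h1 : ∀ i : Fin 53, (Cell (lawShift 1) 1 1605 210 1604 268 (-4472) (i.val + 1) ↔ i.val + 1 ≤ 29) := by
    unfold Cell lawShift; decide
  have h2 : ∀ i : Fin 53, (Cell (lawAffine 2) 1 1605 210 1604 268 (-4472) (i.val + 1) ↔ i.val + 1 ≤ 15) := by
    unfold Cell lawAffine; decide
  refine ⟨fun j hj hjL => ?_, fun j hj hjL => ?_⟩
  · obtain ⟨i, rfl⟩ : ∃ i, j = i + 1 := ⟨j - 1, by omega⟩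
    exact h1 ⟨i, by omega⟩
  · obtain ⟨i, rfl⟩ : ∃ i, j = i + 1 := ⟨j - 1, by omega⟩
    exact h2 ⟨i, by omega⟩

/-- **`T` AT THE WORKED PLACE, per law, in label units** (× `m_q u_w` for nats): print `T = S(53) − S(31) = 50986 − 10385 = 40601` (referee WP-GRID:
`MM = 10707060 = 210·50986`, `μ₄ = 0.20368 = 10385/50986`); `κ = 1`: `0` and `κ = 3/2`: `0` — VANISHES (part 1 `worked_kappaOne_all`,
`worked_kappaThreeHalves_all`); shift `a = 1`: `53742 − 9338 = 44404`; affine `c₁ = 2`: `102025 − 2465 = 99560` (both `> 40601`: INCREASES side); and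
`T_{κ=5/2}, T_{κ=3} ≥ 40601` by the κ-chain, no root evaluated. [folklore] -/
theorem worked_offDemand :
    offDemand (fun j => (j : ℤ) ^ 2) 1 1605 210 1604 268 (-4472) 53 = 40601 ∧
      offDemand (fun j => (j : ℤ)) 1 1605 210 1604 268 (-4472) 53 = 0 ∧
        offDemand (lawPow 3) 1 1605 210 1604 268 (-4472) 53 = 0 ∧
          offDemand (lawShift 1) 1 1605 210 1604 268 (-4472) 53 = 44404 ∧
            offDemand (lawAffine 2) 1 1605 210 1604 268 (-4472) 53 = 99560 ∧
              40601 ≤ offDemand (lawPow 5) 1 1605 210 1604 268 (-4472) 53 ∧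
                40601 ≤ offDemand (lawPow 6) 1 1605 210 1604 268 (-4472) 53 := by
  have hP : offDemand (fun j => (j : ℤ) ^ 2) 1 1605 210 1604 268 (-4472) 53 = 40601 := by
    rw [offDemand_eq_of_boundary (by norm_num) worked_print_boundary]
    have h53 := six_mul_demandSum_sq 53
    have h31 := six_mul_demandSum_sq 31
    push_cast at h53 h31
    linarith
  refine ⟨hP, ?_, ?_, ?_, ?_, ?_, ?_⟩
  · exact offDemand_eq_zero_of_forall_cell fun j hj _ => worked_kappaOne_all hj
  · exact offDemand_eq_zero_of_forall_cell fun j hj hjL => worked_kappaThreeHalves_all hj hjL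
  · rw [offDemand_eq_of_boundary (by norm_num) worked_shift_affine_boundary.1]
    have h53 := six_mul_demandSum_shift 1 53
    have h29 := six_mul_demandSum_shift 1 29
    push_cast at h53 h29
    linarith
  · rw [offDemand_eq_of_boundary (by norm_num) worked_shift_affine_boundary.2]
    have h53 := six_mul_demandSum_affine 2 1 53
    have h15 := six_mul_demandSum_affine 2 1 15
    push_cast at h53 h15
    linarith
  · have h := (offDemand_kappa_chain (by norm_num : (0 : ℤ) < 1605) (by norm_num : (0 : ℤ) ≤ 210) 1604 268 (-4472) 53).2.2.1
    rw [(offDemand_lawPow_two_four_six 1605 210 1604 268 (-4472) 53).2.1, hP] at h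
    exact h
  · have hc := offDemand_kappa_chain (by norm_num : (0 : ℤ) < 1605) (by norm_num : (0 : ℤ) ≤ 210) 1604 268 (-4472) 53
    have h4 := (offDemand_lawPow_two_four_six 1605 210 1604 268 (-4472) 53).2.1
    rw [h4, hP] at hc
    linarith [hc.2.2.1, hc.2.2.2]

/-- **THE KEPT SIDE IS NOT MONOTONE IN THE LAW — the worked place shows it**: `K_L0` (label units) is `S(31) = 10385` at print but only
`Σ_{j≤53}(j − 1) = 1378` under `κ = 1` (every label licensed, each credited less), while `T` drops from `40601` to `0`. Hence only the SIGN of `T` is a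
theorem; the ratio words `ρ⁰, ρ` at `μ₀ < 1` are the engines' numbers (REQB-TABLE v1). [folklore] -/
theorem worked_keptDemand :
    keptDemand (fun j => (j : ℤ) ^ 2) 1 1605 210 1604 268 (-4472) 53 = 10385 ∧
      keptDemand (fun j => (j : ℤ)) 1 1605 210 1604 268 (-4472) 53 = 1378 := by
  refine ⟨?_, ?_⟩
  · rw [keptDemand_eq_of_boundary (by norm_num) worked_print_boundary]
    have h31 := six_mul_demandSum_sq 31
    push_cast at h31
    linarith
  · rw [keptDemand_eq_of_boundary le_rfl (fun j hj hjL => ⟨fun _ => hjL, fun _ => worked_kappaOne_all hj⟩)]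
    have h53 := two_mul_demandSum_id 53
    push_cast at h53
    linarith

end Summit.ABC.IUTFork.Repair.RH.ReqsideWeightLaws

end
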